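import Mathlib

/-!
(v3 2026-08-29 g32: byte-identical to v2 below this header except the `set_option linter.dupNamespace false` line and one `push_neg` ↦ `rw [not_lt]` (deprecation) —
the 80/57 `dupNamespace` warnings came from the MANDATED duplicate `ResolutionOfSingularities.ResolutionOfSingularities`, as in
every tree file of this summit, e.g. ✓p569735 `…LiftCoreLocal.lean` :42; no declaration changed.)
# R21 — the certificate ledger of a fibre-pair tower word, read off the fan

res-L1-w45b-idea-1 g30 · card `Ideas/toric-towers.md` ROUND 21 · memo `R21-CERTIFICATE-LEDGER.md` · tool `r21/ledger.py`.
OURS, counted 0, AI-written (weaker than expert review); nothing here is attributed to Hironaka; nothing of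
`EquisingularLiftNatThree` is proved by this file.  Kernel-checked bookkeeping only (`decide`, `omega`, `nlinarith`,
`norm_num`): the geometric dictionary (which number is which self-intersection) is argued in the memo, not here.

## The ledger (memo §1–§2)

A tower vertex `v` (a ray of the fan in the plane `χ^⊥`, interior to `N_τ`) carries the Euclid tower `T(μ, ν_v)` of R20;
its S-rounds are hosted sections `C₀ = Γ̄_v ⊂ E_v`, `C_k ⊂ E_{C_{k-1}}`.  The (HR-KEEP) certificate of the `k`-th section at
the moment of its round is
`cert = zp_v + k · a_v − hits`,
where `zp_v = Γ̄_v²` in `E_v` (sum over the ≤ 2 torus-fixed ends of `Γ̄_v` of the exponent products `n·m`), `a_v = −E_v·Γ̄_v`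
(the 2D self-intersection number of `v` in the SLICE FAN `Σ ∩ χ^⊥`: `u_L + u_R = a_v • v`), and `hits` = the number of
S-rounds already executed on the two slice-fan neighbours of `v` (adjacent towers cross `Γ̄_v` once each; tower pairs and
far towers cost nothing).  `DirStepUnobs` for that round ⟺ `cert ≥ −1`.

* `certs` : the evaluator on a CHAIN of towers (vertex `i` has data `zp i`, `a i`; an order is a list of vertex indices);
* `certs_N7_record`, `certs_N7_default` : lead-1's N7 ledgers of record (kit j321911: σ∗ +2, C₁ −1, C₂ +1, σ∗∗ +2; default
  order σ∗, σ∗∗, C₁, C₂ gives C₁² = −2) are the values of `certs` on the chain `(2,1,2)–(3,2,2)` with `zp = [2,0]`, `a = [2,2]`;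
* `certs_N10_*` : the N10 chain `(2,1,2)–(3,2,2)–(4,3,2)` (`zp = [2,0,0]`, heights 1,1,2): the order «C₁ first» is legal
  (`[0,-1,1,1]`), the tool-default order «Z₇, Z₈ first» is not (`C₁² = −2`), and exactly 6 of the 12 interleavings are legal;
* `sweep_cert_ge` : the one-line inequality behind the LEGAL-ORDER rule: with `zp ≥ 0`, `a ≥ 2` and at most `2k+1` hits
  before the level-`k` round (level-by-level sweep along the chain), every certificate is `≥ −1`;
* `zipper_*` : the two-tower case in closed form;
* Part C: the slice-fan identities of record (`u_L + u_R = 2 • v` for the tower vertices of N7/N10/N11, `= 3 • v` for C11a's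
  `(3,2,2)`), i.e. `a_v = 2, 2, 2, 3` — the `e = −2 / −3` column of the tool.
-/

set_option linter.dupNamespace false -- mandated namespace `Summit.<Summit>.<Problem>` of this single-conjunct summit (v3, panel nit n-B)

namespace Summit.ResolutionOfSingularities.ResolutionOfSingularities.Cruxes.EquisingularLiftNatThree.ToricTowers.R21

/-! ## Part A — the chain evaluator -/

/-- number of occurrences of vertex `i` in the prefix `pre`. -/
def cnt (pre : List ℕ) (i : ℕ) : ℤ := (pre.count i : ℤ)

/-- certificate of the round fired at position `j` of `order` on a chain with data `zp`, `a` (lists indexed by vertex):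
`zp_i + (#earlier rounds of i)·a_i − (#earlier rounds of i−1) − (#earlier rounds of i+1)`. -/
def certAt (zp a : List ℤ) (order : List ℕ) (j : ℕ) : ℤ :=
  let i := order.getD j 0
  let pre := order.take j
  zp.getD i 0 + cnt pre i * a.getD i 0 - (if i = 0 then 0 else cnt pre (i - 1)) - cnt pre (i + 1)

/-- the whole ledger of an order. -/
def certs (zp a : List ℤ) (order : List ℕ) : List ℤ :=
  (List.range order.length).map (certAt zp a order)

/-- legality of an order: every certificate `≥ −1`. -/
def legal (zp a : List ℤ) (order : List ℕ) : Bool :=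
  (certs zp a order).all (fun c => decide (-1 ≤ c))

/-! ### N7 (lead-1's SELFINT ledger, kit j321911): vertex 0 = E_(2,1,2) (σ∗, σ∗∗), vertex 1 = E_(3,2,2) (C₁, C₂). -/

theorem certs_N7_record : certs [2, 0] [2, 2] [0, 1, 1, 0] = [2, -1, 1, 2] := by decide
theorem certs_N7_default : certs [2, 0] [2, 2] [0, 0, 1, 1] = [2, 4, -2, 0] := by decide
theorem legal_N7_record : legal [2, 0] [2, 2] [0, 1, 1, 0] = true := by decide
theorem illegal_N7_default : legal [2, 0] [2, 2] [0, 0, 1, 1] = false := by decide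
/-- the best N7 order: C₁ first (all certificates ≥ 0). -/
theorem certs_N7_best : certs [2, 0] [2, 2] [1, 0, 1, 0] = [0, 1, 1, 2] := by decide

/-- all interleavings of `S,S` over vertex 0 with `S,S` over vertex 1. -/
def ordersN7 : List (List ℕ) :=
  [[0,0,1,1],[0,1,0,1],[0,1,1,0],[1,0,0,1],[1,0,1,0],[1,1,0,0]]
theorem N7_legal_count : (ordersN7.filter (legal [2, 0] [2, 2])).length = 5 := by decide

/-! ### N8: vertex 0 = E_(2,1,2) (σ∗ only, ν = 3), vertex 1 = E_(3,2,2) (C₁, C₂). -/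
theorem certs_N8_record : certs [2, 0] [2, 2] [0, 1, 1] = [2, -1, 1] := by decide
theorem certs_N8_best : certs [2, 0] [2, 2] [1, 1, 0] = [0, 2, 0] := by decide

/-! ### N10 = (x²+y²z)² + x⁵ + z¹⁰ + xy⁹ + … (lead-1 FINDING 4): chain 0 = E_(2,1,2) (σ∗), 1 = E_(3,2,2) (C₁),
2 = E_(4,3,2) = E_{Z₆} (Z₇, Z₈); `zp = [2,0,0]`, `a = [2,2,2]` (tool `ledger.py auto N10`). -/

theorem certs_N10_C1_first : certs [2, 0, 0] [2, 2, 2] [1, 2, 2, 0] = [0, -1, 1, 1] := by decide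
theorem certs_N10_Z7_first : certs [2, 0, 0] [2, 2, 2] [2, 1, 2, 0] = [0, -1, 1, 1] := by decide
theorem certs_N10_default : certs [2, 0, 0] [2, 2, 2] [2, 2, 1, 0] = [0, 2, -2, 1] := by decide
theorem certs_N10_worst : certs [2, 0, 0] [2, 2, 2] [2, 2, 0, 1] = [0, 2, 2, -3] := by decide

def ordersN10 : List (List ℕ) :=
  [[0,1,2,2],[0,2,1,2],[0,2,2,1],[1,0,2,2],[1,2,0,2],[1,2,2,0],
   [2,0,1,2],[2,0,2,1],[2,1,0,2],[2,1,2,0],[2,2,0,1],[2,2,1,0]]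
/-- exactly half of the twelve interleavings of N10's towers are certificate-legal. -/
theorem N10_legal_count : (ordersN10.filter (legal [2, 0, 0] [2, 2, 2])).length = 6 := by decide
/-- … and «C₁ within the first two Γ-rounds, not after two neighbour rounds» characterises them. -/
theorem N10_legal_orders :
    ordersN10.filter (legal [2, 0, 0] [2, 2, 2]) =
      [[0,1,2,2],[1,0,2,2],[1,2,0,2],[1,2,2,0],[2,1,0,2],[2,1,2,0]] := by decide

/-! ### N11 (z¹¹): 4-chain (2,1,2)–(3,2,2)–(4,3,2)–(5,4,2), zp = [2,0,0,2], heights 1,1,2,1. -/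
theorem certs_N11_sweep : certs [2, 0, 0, 2] [2, 2, 2, 2] [1, 2, 2, 3, 0] = [0, -1, 1, 0, 1] := by decide
theorem certs_N11_bad : certs [2, 0, 0, 2] [2, 2, 2, 2] [0, 2, 2, 3, 1] = [2, 0, 2, 0, -3] := by decide

/-! ## Part B — the legal-order inequalities -/

/-- The sweep bound: on a chain, fire the rounds level by level, each level from one end to the other.  Before the
level-`k` round of a vertex, its two neighbours have fired at most `k+1` and `k` times: `hits ≤ 2k+1`.  With `zp ≥ 0`
and slice self-intersection `a ≥ 2` the certificate `zp + k·a − hits` is `≥ −1`. -/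
theorem sweep_cert_ge (zp a k hits : ℤ) (hzp : 0 ≤ zp) (ha : 2 ≤ a) (hk : 0 ≤ k) (hh : hits ≤ 2 * k + 1) :
    -1 ≤ zp + k * a - hits := by nlinarith

/-- … and it is sharp in `a`: with `a = 1` a vertex of height `k+1 ≥ zp + 2` flanked by two towers of the same height
receives certificate `zp + k − (2k+1) = zp − k − 1 < −1`. -/
theorem sweep_fails_at_a_one (zp k : ℤ) (hk : zp + 1 ≤ k) : zp + k * 1 - (2 * k + 1) < -1 := by linarith

/-- Inside one tower (no foreign hits) the certificates increase: `zp + (k+1)a > zp + k a` for `a ≥ 1`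
(relative ampleness gives `a = −E_v·Γ̄_v ≥ 1`, memo §1 (e)). -/
theorem tower_monotone (zp a k : ℤ) (ha : 1 ≤ a) : zp + k * a < zp + (k + 1) * a := by nlinarith

/-- Two adjacent towers in ZIPPER order `v₀ w₀ v₁ w₁ …`: before `v_k` the neighbour fired `k` times, before `w_k` it fired
`k+1` times. Both stay `≥ −1` as soon as `zp ≥ 0` and `a ≥ 1` — for two towers even `a = 1` suffices. -/
theorem zipper_v (zp a k : ℤ) (hzp : 0 ≤ zp) (ha : 1 ≤ a) (hk : 0 ≤ k) : -1 ≤ zp + k * a - k := by nlinarith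
theorem zipper_w (zp a k : ℤ) (hzp : 0 ≤ zp) (ha : 1 ≤ a) (hk : 0 ≤ k) : -1 ≤ zp + k * a - (k + 1) := by nlinarith

/-- TOWER-BY-TOWER order can fail: if the neighbour tower of height `h ≥ zp + 2` is finished first, the first section of
`v` has certificate `zp − h < −1` (N7 default order: `zp = 0`, `h = 2`, `C₁² = −2`). -/
theorem tower_by_tower_fails (zp h : ℤ) (hh : zp + 2 ≤ h) : zp - h < -1 := by linarith

/-! ## Part C — slice-fan identities of record (`u_L + u_R = a_v • v` in `χ^⊥`, `χ = (−2,2,1)`)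

The plane neighbours are read off the tool output (`ledger.py`): a real neighbour is an adjacent fan ray in `χ^⊥`,
a virtual one is `m•a + n•b` for a torus-fixed end `O_{v,a,b}` with `⟨a,χ⟩ = n > 0 > −m = ⟨b,χ⟩`. -/

def chi : Fin 3 → ℤ := ![-2, 2, 1]
def pair (u v : Fin 3 → ℤ) : ℤ := u 0 * v 0 + u 1 * v 1 + u 2 * v 2

/-- the tower vertices and their plane neighbours all lie in `χ^⊥`. -/
theorem in_plane :
    pair ![2,1,2] chi = 0 ∧ pair ![3,2,2] chi = 0 ∧ pair ![4,3,2] chi = 0 ∧ pair ![5,4,2] chi = 0 ∧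
    pair ![1,0,2] chi = 0 ∧ pair ![6,5,2] chi = 0 ∧ pair ![7,5,4] chi = 0 ∧ pair ![11,8,6] chi = 0 := by
  simp [pair, chi]

/-- N7/N8/N10: `v = (2,1,2)`: virtual end `2•Zp + 1•Pi = (1,0,2)` (exponents (1,2), so `zp = 2`) and real neighbour
`(3,2,2)`: `a = 2`. -/
theorem slice_212 : (![1,0,2] : Fin 3 → ℤ) + ![3,2,2] = 2 • ![2,1,2] := by decide
/-- `v = (3,2,2)` between the real rays `(2,1,2)` and `(4,3,2)`: `zp = 0`, `a = 2`. -/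
theorem slice_322 : (![2,1,2] : Fin 3 → ℤ) + ![4,3,2] = 2 • ![3,2,2] := by decide
/-- N10/N11: `v = (4,3,2)` between `(3,2,2)` and `(5,4,2)` (real in N10 after the pair `(E_φ′, E_(3,2,1))`, virtual
`2•E_φ′ + Pi` in N7): `a = 2`. -/
theorem slice_432 : (![3,2,2] : Fin 3 → ℤ) + ![5,4,2] = 2 • ![4,3,2] := by decide
/-- N11: `v = (5,4,2)` between `(4,3,2)` and the virtual `Y + 2•(3,2,1) = (6,5,2)`: `a = 2`. -/
theorem slice_542 : (![4,3,2] : Fin 3 → ℤ) + ![6,5,2] = 2 • ![5,4,2] := by decide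
/-- C11a (cubed umbrella): `v = (3,2,2)` between `(2,1,2)` and `(7,5,4)`: `a = 3` (tool: `e = −3`). -/
theorem slice_322_C11a : (![2,1,2] : Fin 3 → ℤ) + ![7,5,4] = 3 • ![3,2,2] := by decide
/-- C11a: `v = (7,5,4)` between `(3,2,2)` and `(11,8,6)`: `a = 2`. -/
theorem slice_754 : (![3,2,2] : Fin 3 → ℤ) + ![11,8,6] = 2 • ![7,5,4] := by decide
/-- the would-be `a = 1` configuration the sweep bound excludes: `(7,5,4) = (3,2,2) + (4,3,2)` — a tower vertex whose
plane neighbours at tower time were `(3,2,2)` and `(4,3,2)` would have `E_v·Γ̄_v = −1` (memo §4, question R21-Q). -/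
theorem slice_754_virtual : (![3,2,2] : Fin 3 → ℤ) + ![4,3,2] = (1 : ℤ) • ![7,5,4] := by decide

/-- exponent products at the fixed ends = `zp`: `(2,1,2)`'s end `O_{v,Zp,Pi}` has `(⟨Zp,χ⟩, ⟨Pi,χ⟩) = (1, −2)`,
product 2 = σ∗² at its round (lead-1: +3 at birth, +2 after σ_S; the fan at tower time already shows 2). -/
theorem zp_212 : pair ![0,0,1] chi * (- pair ![1,0,0] chi) = 2 := by simp [pair, chi]


/-! ## Part D — R21-Q1 («is `a_v ≥ 2` forced at interior chain vertices?»): the OUTSIDE LEMMA, arithmetic core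

Door scan (`r21/doors.py`, box of 268 + kit j322820 over the 800 randomized customers): an interior plane ray `w` with
`a_w = 1` and two REAL plane neighbours does occur at the fan level (`(7,5,4) = (3,2,2) + (4,3,2)` in `U3_x8_xz9_xy12`, …),
but always with one neighbour OUTSIDE `N_τ` (tail-dominated, hence never a tower vertex).  The mechanisms and why:
* a plane–plane wall `⟨u,o⟩` is singular only if one of `u,o` is outside `N_τ` (inside, every edge monomial has excess 0,
  so `mult₂ = 0`); its blow-up `w = u + o` has `a_w = 1` next to the outside ray `o` — the isolated `(3,1,4) = (2,1,2)+(1,0,2)`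
  of the box and the `(7,5,4)` above are both of this kind;
* a point blow-up `{a,b,u}` with `ψ(u) = 0`, `ψ(a) = α = −ψ(b)` needs `α = 1` (unimodularity: `(α, −α, 0)` generate `ℤ`,
  `balanced_end_alpha_one`), inserts `w' = a+b+u` between `u` and the direction `d = a+b` (`a_{w'} = 1` w.r.t. `u, d`); `d` becomes
  real only if the wall `⟨a,b⟩` is singular, i.e. its tail part `T ≥ 2`; a max-multiplicity walker takes the POINT before the
  CURVE only if `mult₃ > mult₂`, i.e. `T < μ` (`point_first_iff`), and then the tail is minimal at `d` (`outside_of_point_first`):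
  `d ∉ N_τ`, so `w'` is again adjacent to an outside ray;
* a point blow-up `{a,b,c}` with signs `(+,+,−)`/`(+,−,−)` inserts `w' = a+b+c` with `a_{w'} = (β+γ)/gcd(β,γ) ≥ 2`
  (`point_insertion_selfint_ge_two`).
What is NOT covered here (R21-Q1 residual): a balanced pair `⟨a,b⟩` flanked by two real plane rays `z₁,z₂` with
`z₁ + z₂ = a + b` (λ = 1 flop quadrilateral) — never observed (0 of 268 + 800), no fan-level exclusion typed. -/

/-- unimodularity at a balanced end: if `{a,b,u}` is a lattice basis with `ψ(u) = 0`, `ψ(a) = α`, `ψ(b) = −α` and `ψ`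
primitive, then `α` and `α` are coprime, hence `α = 1`. -/
theorem balanced_end_alpha_one (α : ℕ) (h : Nat.Coprime α α) : α = 1 := by
  simpa [Nat.Coprime] using h

/-- the plane ray inserted by a point blow-up `{a,b,c}` with `ψ = (β+γ, −β, −γ)` has slice neighbours
`(βa+αb)/g`, `(γa+αc)/g` (`g = gcd(β,γ)`) summing to `((β+γ)/g) • (a+b+c)`: its self-intersection number is
`(β+γ)/g = β/g + γ/g ≥ 2`. -/
theorem point_insertion_selfint_ge_two (β γ : ℕ) (hβ : 1 ≤ β) (hγ : 1 ≤ γ) :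
    2 ≤ β / Nat.gcd β γ + γ / Nat.gcd β γ := by
  have hg : 0 < Nat.gcd β γ := Nat.gcd_pos_of_pos_left _ (by omega)
  have h1 : 1 ≤ β / Nat.gcd β γ := (Nat.le_div_iff_mul_le hg).2 (by simpa using Nat.le_of_dvd (by omega) (Nat.gcd_dvd_left β γ))
  have h2 : 1 ≤ γ / Nat.gcd β γ := (Nat.le_div_iff_mul_le hg).2 (by simpa using Nat.le_of_dvd (by omega) (Nat.gcd_dvd_right β γ))
  omega

/-- with `α = β` the edge monomials `m₀ + j•χ'` (`j = 0..μ`) all have the same excess `(μ − j)α + jα = μα` at `a + b (+ u)`: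
the inserted ray is a PLANE ray. -/
theorem edge_excess_balanced (μ j α : ℕ) (hj : j ≤ μ) : (μ - j) * α + j * α = μ * α := by
  rw [← Nat.add_mul, Nat.sub_add_cancel hj]

/-- POINT FIRST ⟺ `T < μ`: along the wall `⟨a,b⟩` (`α = β = 1`) the multiplicity is `min μ T` (`T` = tail part), at its
point with the plane ray `u` it is at least `min μ (T + ν)` with `ν ≥ 1` the tail excess at `u`; the point is strictly more
singular than the curve iff `T < μ`. -/
theorem point_first_iff (μ T ν : ℕ) (hν : 1 ≤ ν) : min μ T < min μ (T + ν) ↔ T < μ := by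
  constructor
  · intro h
    by_contra hc
    rw [not_lt] at hc
    have : min μ T = μ := Nat.min_eq_left hc
    have h2 : min μ (T + ν) ≤ μ := Nat.min_le_left _ _
    omega
  · intro h
    have : min μ T = T := Nat.min_eq_right (le_of_lt h)
    rw [this]
    apply lt_min h; omega

/-- … and then the direction `d = a + b` is OUTSIDE `N_τ`: at `d` the tail value `D + T` is below the edge value `D + μ`
(`D = d_a + d_b`), so no tower lives over `d` and the inserted `w' = u + d` is adjacent to a non-tower ray. -/
theorem outside_of_point_first (D μ T : ℕ) (h : T < μ) : D + T < D + μ := by omega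

/-- conversely CURVE FIRST (`μ ≤ T`): `d` is inside `N_τ` (edge minimal at `d`) and the curve and its point have the same
multiplicity `μ`, so a walker that prefers the larger centre at equal multiplicity never inserts `w'`. -/
theorem curve_first_equal_mult (μ T ν : ℕ) (h : μ ≤ T) : min μ T = μ ∧ min μ (T + ν) = μ := by
  constructor <;> apply Nat.min_eq_left <;> omega

/-! ### The realised fan-level door `(7,5,4) = (3,2,2) + (4,3,2)` of `U3_x8_xz9_xy12` = `(x²+y²z)³ + x⁸ + xz⁹ + xy¹²`
(values `⟨v,m⟩` over the support; `dmin` = order of `f` along `v`; excess = value − `dmin`). -/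

def val (v m : Fin 3 → ℕ) : ℕ := v 0 * m 0 + v 1 * m 1 + v 2 * m 2
/-- support of `(x²+y²z)³ + x⁸ + xz⁹ + xy¹²`: the four edge monomials, then the three tails. -/
def suppU3 : List (Fin 3 → ℕ) := [![6,0,0], ![4,2,1], ![2,4,2], ![0,6,3], ![8,0,0], ![1,0,9], ![1,12,0]]
def dmin (v : Fin 3 → ℕ) : ℕ := ((suppU3.map (val v)).min?).getD 0
def exc (v m : Fin 3 → ℕ) : ℕ := val v m - dmin v
def mult₂ (a b : Fin 3 → ℕ) : ℕ := ((suppU3.map fun m => exc a m + exc b m).min?).getD 0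

/-- `(3,2,2)` is inside `N_τ`: order 18 attained by all four edge monomials, tails 24/21/27 (ν = 3 → tower `S₃`). -/
theorem U3_v322 : suppU3.map (val ![3,2,2]) = [18,18,18,18,24,21,27] ∧ dmin ![3,2,2] = 18 := by decide
/-- `(4,3,2)` is OUTSIDE `N_τ`: the tail `xz⁹` has value 22 < 24 = edge value. -/
theorem U3_v432_outside : suppU3.map (val ![4,3,2]) = [24,24,24,24,32,22,40] ∧ dmin ![4,3,2] = 22 := by decide
/-- hence the plane–plane wall `⟨(3,2,2),(4,3,2)⟩` IS singular: `mult₂ = 2` (from `x⁶`: excess 0 + 2). -/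
theorem U3_wall_singular : mult₂ ![3,2,2] ![4,3,2] = 2 := by decide
/-- its blow-up `(7,5,4)` is inside `N_τ` with `ν = 1` (edge 42, tail `xz⁹` 43): no tower (`T(3,1) = ∅`), `a = 1`
(`slice_754_virtual`), flanked by the tower vertex `(3,2,2)` and the OUTSIDE ray `(4,3,2)` — an isolated `a = 1`, no door. -/
theorem U3_v754 : suppU3.map (val ![7,5,4]) = [42,42,42,42,56,43,67] ∧ dmin ![7,5,4] = 42 := by decide
/-- and the next wall `⟨(7,5,4),(4,3,2)⟩` is no longer singular (`mult₂ = 1`, from `xz⁹`: 1 + 0): the march stops. -/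
theorem U3_next_wall_regular : mult₂ ![7,5,4] ![4,3,2] = 1 := by decide
/-- while a plane–plane wall with both rays inside `N_τ` is never singular: `⟨(3,2,2),(2,1,2)⟩` has `mult₂ = 0`. -/
theorem U3_inside_wall_regular : mult₂ ![3,2,2] ![2,1,2] = 0 ∧ dmin ![2,1,2] = 12 := by decide

end Summit.ResolutionOfSingularities.ResolutionOfSingularities.Cruxes.EquisingularLiftNatThree.ToricTowers.R21
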